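import Summits.ResolutionOfSingularities.ResolutionOfSingularities.Theorems.EquisingularLiftEquisingularLiftNatDirectionChartData
import Literature.AlgebraicGeometry.Modules.FrameRestriction
import Literature.AlgebraicGeometry.Modules.FrameTransition
import HarnessLib

/-!
# Route `EquisingularLift`, crux EL♮(3) (stmt-ResolutionOfSingularities-20148) — (L) C3⁺ brick (C3-ii): the LIFTED COLUMN at a point

res-rescue-typ-5 g3 as a w45b pool hand (res-L1-w45b-stub-4 g9 DEAL 2026-08-27T23:16:25Z «(C3-ii) → res-rescue-typ-5»); the signature of
`exists_dirLift_chartColumn` is l.53–75 of stub-4's `L/res-L1-w45b-stub-4/DirLiftSkeleton-v2.lean` (sha16 db5114efb4ea3c7d) VERBATIM.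
OURS; NOT a statement of any manuscript; AI-written, weaker than expert review. No `sorry`; standard axioms; DEF-FREE;
`--supports stmt-ResolutionOfSingularities-20148 --as helper`.

## What it says and how it is proved
For a codimension-`2` regular immersion `ι = I.subschemeι : C ↪ X₀`, an iso `e : C ≅ Y`, a rank-`1` locally free `K` on `Y` and a locally
split `σ : K → e.inv^* 𝒞` (`𝒞` the conormal sheaf), at every `y : Y` there is conormal chart data `(V, x, s, eV)` at `ι (e.inv y)`
(generators `x` of `I(V)`, ideal-module sections `s` reading to `x`, a conormal frame `eV` with basis sections `η(s_j)`), a rank-`1` frame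
`κ` of `K` on some `W ⊇ e.inv⁻¹ι⁻¹V`, and LIFTS `A_j ∈ Γ(X₀, V)` of the coordinates of `σ(κ₀)|` in the pulled-back frame `e.inv^* eV`,
UNIMODULAR modulo `I(V)` (witness `r`). Steps: (1) frames `κ` on `W_κ ∋ y` (`hK`) and a retraction `r` of `σ` on `W_r ∋ y` (`hσsplit`);
(2) conormal chart data at `z := e.inv y` on an affine `V₀` exactly as res-D-pv-051's `exists_directionChartData` (regular generators
`hri.2 z`, `exists_basis_sections_pullback_idealModule_eq`, `nonempty_free_iso_over_of_basis`, `exists_frame_of_basis`); (3) SHRINK: `ι`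
is a closed embedding and `e` a homeomorphism, so some open `t ⊆ X₀` has `ι⁻¹ t = e.hom⁻¹(W_κ ⊓ W_r)`; take an affine `V ∋ ι z` inside
`V₀ ⊓ t`, restrict generators / sections / frame (`map_ideal`, `map_toRing`, `restrictTrivialisation`, `unitSection_map`); (4) coordinates
`A♭_j := coord (pullbackFrame e.inv eV) (𝟙 _) (σ(κ₀)|)` (`eq_sum_coord_smul`); (5) unimodularity downstairs: apply `r` (which sends
`σ(κ₀)|` back to `κ₀|`) and take the `κ`-coordinate: `1 = Σ_j A♭_j · r♭_j`; (6) LIFT `A♭_j`, `r♭_j ∈ Γ(Y, e.inv⁻¹ι⁻¹V)` to `Γ(X₀, V)`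
along `a ↦ e.inv♯(ι♯ a)` (surjective: `subschemeι_app_surjective` + `e.inv♯` iso; kernel `I(V)`: `ker_subschemeι_app`) — the clause
`Σ r_j A_j − 1 ∈ I(V)` is exactly that kernel statement.
-/

noncomputable section

-- `TopCat.Presheaf`/`Scheme.Modules` are not reducible (as in Mathlib's `AlgebraicGeometry/Modules`).
set_option backward.isDefEq.respectTransparency false

open CategoryTheory CategoryTheory.Limits AlgebraicGeometry Opposite TopologicalSpace Topology
open Literature.AlgebraicGeometry.Modules Literature.AlgebraicGeometry.Morphisms
open Literature.AlgebraicGeometry.Deformation Literature.AlgebraicGeometry.Motives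
open Literature.AlgebraicGeometry.HodgeTheory Literature.AlgebraicGeometry.Resolution
open AlgebraicGeometry.Scheme.IdealSheafData

set_option linter.dupNamespace false -- mandated namespace `Summit.<Summit>.<Problem>` of this single-conjunct summit

namespace Summit.ResolutionOfSingularities.ResolutionOfSingularities.Cruxes.EquisingularLiftNat.Sections

open Summit.ResolutionOfSingularities.ResolutionOfSingularities.Cruxes.EquisingularLiftNat.P1VB

/-! ## Plumbing -/

/-- **Opens of a closed subscheme transported through an iso are cut out by opens of the ambient scheme**: for a closed immersion
`ι : C ⟶ X₀`, an iso `e : C ≅ Y` and an open `W' ⊆ Y`, some open `t ⊆ X₀` has `e.inv⁻¹(ι⁻¹ t) = W'`… stated as the two inclusions we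
use: `ι z ∈ t ↔ e.hom z ∈ W'`. [folklore] -/
theorem exists_open_preimage_eq {C X₀ Y : Scheme.{0}} (ι : C ⟶ X₀) [IsClosedImmersion ι] (e : C ≅ Y) (W' : Y.Opens) :
    ∃ t : X₀.Opens, ∀ z : C, ι z ∈ t ↔ e.hom z ∈ W' := by
  obtain ⟨t, ht, hpre⟩ := (ι.isClosedEmbedding.isInducing.isOpen_iff).mp (e.hom ⁻¹ᵁ W').2
  refine ⟨⟨t, ht⟩, fun z => ?_⟩
  have h : z ∈ ι.base ⁻¹' t ↔ z ∈ ((e.hom ⁻¹ᵁ W' : C.Opens) : Set C) := by rw [hpre]; exact Iff.rfl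
  exact h

/-- `e.hom (e.inv y) = y` for an iso of schemes. [folklore] -/
theorem iso_hom_inv_apply {C Y : Scheme.{0}} (e : C ≅ Y) (y : Y) : e.hom (e.inv y) = y := by
  change (e.inv ≫ e.hom).base y = y
  rw [e.inv_hom_id]
  rfl

/-- **Lifting sections from `Y ≅ C` to an affine of `X₀`**: every `a ∈ Γ(Y, e.inv⁻¹ι⁻¹V)` is `e.inv♯(ι♯ A)` for some `A ∈ Γ(X₀, V)`
(`ι♯` is surjective on affines, `e.inv♯` is an iso). [folklore] -/
theorem exists_lift_section {X₀ Y : Scheme.{0}} (I : X₀.IdealSheafData) (e : I.subscheme ≅ Y) (V : X₀.affineOpens)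
    (a : Γ(Y, e.inv ⁻¹ᵁ (I.subschemeι ⁻¹ᵁ (V : X₀.Opens)))) :
    ∃ A : Γ(X₀, (V : X₀.Opens)), e.inv.app _ (I.subschemeι.app (V : X₀.Opens) A) = a := by
  obtain ⟨A, hA⟩ := I.subschemeι_app_surjective V (inv (e.inv.app (I.subschemeι ⁻¹ᵁ (V : X₀.Opens))) a)
  refine ⟨A, ?_⟩
  rw [hA, ← CommRingCat.comp_apply, IsIso.inv_hom_id]
  rfl

/-- **The kernel of `a ↦ e.inv♯(ι♯ a)` on an affine `V` is `I(V)`.** [folklore] -/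
theorem mem_ideal_of_app_eq_zero {X₀ Y : Scheme.{0}} (I : X₀.IdealSheafData) (e : I.subscheme ≅ Y) (V : X₀.affineOpens)
    (A : Γ(X₀, (V : X₀.Opens))) (h : e.inv.app _ (I.subschemeι.app (V : X₀.Opens) A) = 0) : A ∈ I.ideal V := by
  rw [← ker_subschemeι_app I V, RingHom.mem_ker]
  have hinj : Function.Injective (e.inv.app (I.subschemeι ⁻¹ᵁ (V : X₀.Opens))) :=
    (asIso (e.inv.app (I.subschemeι ⁻¹ᵁ (V : X₀.Opens)))).commRingCatIsoToRingEquiv.injective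
  apply hinj
  rw [h, map_zero]

/-! ## The brick -/

set_option maxHeartbeats 400000 in
/-- **(C3-ii) the lifted column at a point** (signature = stub-4's `DirLiftSkeleton-v2.lean` l.53–75 VERBATIM). See the module docstring for
the statement in words and the proof. [OURS · L1 W4.5b (L) C3⁺] -/
theorem exists_dirLift_chartColumn {X₀ Y : Scheme.{0}} [IsLocallyNoetherian X₀] (I : X₀.IdealSheafData)
    (hri : IsRegularImmersionOfCodim I.subschemeι 2) (e : I.subscheme ≅ Y) (K : Y.Modules)
    (hK : ∀ y : Y, ∃ (W : Y.Opens) (_ : y ∈ W), Nonempty (SheafOfModules.free (Fin 1) ≅ K.over W))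
    (σ : K ⟶ (Scheme.Modules.pullback e.inv).obj (conormalSheaf I.subschemeι))
    (hσsplit : ∀ y : Y, ∃ (W : Y.Opens) (_ : y ∈ W)
      (r : ((Scheme.Modules.pullback e.inv).obj (conormalSheaf I.subschemeι)).over W ⟶ K.over W),
      (SheafOfModules.overFunctor _ W).map σ ≫ r = 𝟙 _)
    (y : Y) :
    ∃ (V : X₀.affineOpens) (_ : I.subschemeι (e.inv y) ∈ (V : X₀.Opens))
      (x : Fin 2 → Γ(X₀, (V : X₀.Opens))) (s : Fin 2 → Γ(idealModule I.subschemeι, (V : X₀.Opens)))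
      (_ : Ideal.span (Set.range x) = I.ideal V)
      (_ : ∀ j, toRing (idealModuleι I.subschemeι) (V : X₀.Opens) (s j) = x j)
      (eV : SheafOfModules.free (Fin 2) ≅ (conormalSheaf I.subschemeι).over (I.subschemeι ⁻¹ᵁ (V : X₀.Opens)))
      (_ : ∀ j, basisSection eV j = unitSectionLE I.subschemeι (idealModule I.subschemeι) (le_refl _) (s j))
      (A r : Fin 2 → Γ(X₀, (V : X₀.Opens))) (_ : (∑ j, r j * A j) - 1 ∈ I.ideal V)
      (W : Y.Opens) (κ : SheafOfModules.free (Fin 1) ≅ K.over W)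
      (hVW : e.inv ⁻¹ᵁ (I.subschemeι ⁻¹ᵁ (V : X₀.Opens)) ≤ W),
      ((Scheme.Modules.pullback e.inv).obj (conormalSheaf I.subschemeι)).presheaf.map (homOfLE hVW).op
          (σ.app W (basisSection κ 0)) =
        ∑ j, e.inv.app _ (I.subschemeι.app (V : X₀.Opens) (A j)) •
          basisSection (E := (Scheme.Modules.pullback e.inv).obj (conormalSheaf I.subschemeι)) (pullbackFrame e.inv eV) j := by

  classical
  haveI : IsClosedImmersion I.subschemeι := inferInstance
  -- (1) frames downstairs at `y`
  obtain ⟨W₁, hyW₁, ⟨κ⟩⟩ := hK y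
  obtain ⟨W₂, hyW₂, r, hr⟩ := hσsplit y
  -- (2) conormal chart data at `z := e.inv y` on an affine `V₀` (as res-D-pv-051's `exists_directionChartData`)
  obtain ⟨V₀, hzV₀, rs, hlen, hreg, hIV⟩ := hri.2 (e.inv y)
  obtain ⟨x0, x1, rfl⟩ := List.length_eq_two.mp hlen
  have hreg' : RingTheory.Sequence.IsWeaklyRegular Γ(X₀, (V₀ : X₀.Opens)) (List.ofFn ![x0, x1]) := by
    rw [list_ofFn_pair]; exact hreg
  have hspan₀ : Ideal.span (Set.range ![x0, x1]) = I.ideal V₀ := by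
    have h : I.ideal V₀ = Ideal.ofList [x0, x1] := by
      rw [hIV, Scheme.IdealSheafData.ker_subschemeι]
    rw [h, span_range_fin_two, Ideal.ofList_cons, Ideal.ofList_singleton, Ideal.span_insert]
    rfl
  have hspan₀' : Ideal.span (Set.range ![x0, x1]) = I.subschemeι.ker.ideal V₀ := by
    rw [Scheme.IdealSheafData.ker_subschemeι]; exact hspan₀
  obtain ⟨s₀, b, hs₀, hb⟩ := exists_basis_sections_pullback_idealModule_eq I.subschemeι V₀ ![x0, x1] hreg' hspan₀'
  obtain ⟨e₀⟩ := nonempty_free_iso_over_of_basis (conormalSheaf I.subschemeι) (coh_conormalSheaf I.subschemeι).loc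
    (V₀.2.preimage I.subschemeι) b
  obtain ⟨eV₀, heV₀⟩ := exists_frame_of_basis e₀ b
  -- (3) shrink `V₀` to an affine `V ∋ ι z` with `e.inv⁻¹ι⁻¹V ≤ W₁ ⊓ W₂`
  obtain ⟨t, ht⟩ := exists_open_preimage_eq I.subschemeι e (W₁ ⊓ W₂)
  have hzt : I.subschemeι (e.inv y) ∈ t := by
    rw [ht, iso_hom_inv_apply]; exact ⟨hyW₁, hyW₂⟩
  obtain ⟨V', hV', hzV', hV'sub⟩ := exists_isAffineOpen_mem_and_subset
    (show I.subschemeι (e.inv y) ∈ (V₀ : X₀.Opens) ⊓ t from ⟨hzV₀, hzt⟩)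
  let V : X₀.affineOpens := ⟨V', hV'⟩
  have hVV₀ : (V : X₀.Opens) ≤ V₀ := fun p hp => (hV'sub hp).1
  have hVt : (V : X₀.Opens) ≤ t := fun p hp => (hV'sub hp).2
  have hVW : e.inv ⁻¹ᵁ (I.subschemeι ⁻¹ᵁ (V : X₀.Opens)) ≤ W₁ ⊓ W₂ := by
    intro y' hy'
    have h1 : I.subschemeι (e.inv y') ∈ t := hVt hy'
    rw [ht, iso_hom_inv_apply] at h1
    exact h1
  have hVW₁ : e.inv ⁻¹ᵁ (I.subschemeι ⁻¹ᵁ (V : X₀.Opens)) ≤ W₁ := hVW.trans inf_le_left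
  have hVW₂ : e.inv ⁻¹ᵁ (I.subschemeι ⁻¹ᵁ (V : X₀.Opens)) ≤ W₂ := hVW.trans inf_le_right
  -- restricted chart data on `V`
  let x : Fin 2 → Γ(X₀, (V : X₀.Opens)) := fun j => secRes X₀ hVV₀ (![x0, x1] j)
  let s : Fin 2 → Γ(idealModule I.subschemeι, (V : X₀.Opens)) := fun j =>
    (idealModule I.subschemeι).presheaf.map (homOfLE hVV₀).op (s₀ j)
  have hgen : Ideal.span (Set.range x) = I.ideal V := by
    rw [← map_secRes_ideal I hVV₀, ← hspan₀, Ideal.map_span, ← Set.range_comp]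
    rfl
  have hs : ∀ j, toRing (idealModuleι I.subschemeι) (V : X₀.Opens) (s j) = x j := by
    intro j
    change toRing (idealModuleι I.subschemeι) (V : X₀.Opens) ((idealModule I.subschemeι).presheaf.map (homOfLE hVV₀).op (s₀ j)) =
      secRes X₀ hVV₀ (![x0, x1] j)
    rw [← map_toRing, hs₀]
  let kV : I.subschemeι ⁻¹ᵁ (V : X₀.Opens) ⟶ I.subschemeι ⁻¹ᵁ (V₀ : X₀.Opens) :=
    (Opens.map I.subschemeι.base).map (homOfLE hVV₀)
  let eV : SheafOfModules.free (Fin 2) ≅ (conormalSheaf I.subschemeι).over (I.subschemeι ⁻¹ᵁ (V : X₀.Opens)) :=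
    SheafOfModules.restrictTrivialisation (R := I.subscheme.ringCatSheaf) kV eV₀
  have heV : ∀ j, basisSection eV j = unitSectionLE I.subschemeι (idealModule I.subschemeι) (le_refl _) (s j) := by
    intro j
    change basisSection (SheafOfModules.restrictTrivialisation (R := I.subscheme.ringCatSheaf) kV eV₀) j = _
    rw [basisSection_restrictTrivialisation, map_basisSection_conormalFrame I s₀ eV₀ (fun j => (heV₀ j).trans (hb j)) kV j,
      unitSectionLE, ← unitSection_map]
    change _ = (conormalSheaf I.subschemeι).presheaf.map (homOfLE (le_refl _)).op _
    rw [Subsingleton.elim (homOfLE (le_refl (I.subschemeι ⁻¹ᵁ (V : X₀.Opens)))) (𝟙 _), op_id,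
      (conormalSheaf I.subschemeι).presheaf.map_id]
    rfl
  -- (4) coordinates of `σ(κ₀)|` in the pulled-back frame
  let F : Y.Modules := (Scheme.Modules.pullback e.inv).obj (conormalSheaf I.subschemeι)
  let Vb : Y.Opens := e.inv ⁻¹ᵁ (I.subschemeι ⁻¹ᵁ (V : X₀.Opens))
  let sb : Γ(F, Vb) := F.presheaf.map (homOfLE hVW₁).op (σ.app W₁ (basisSection κ 0))
  let bj : Fin 2 → Γ(F, Vb) := fun j => basisSection (E := F) (pullbackFrame e.inv eV) j
  let Ab : Fin 2 → Γ(Y, Vb) := fun j => coord (E := F) (pullbackFrame e.inv eV) (𝟙 Vb) sb j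
  have hexp : sb = ∑ j, Ab j • bj j := by
    have h := eq_sum_coord_smul (E := F) (pullbackFrame e.inv eV) (𝟙 Vb) sb
    rw [op_id, F.presheaf.map_id] at h
    exact h
  -- (5) unimodularity downstairs: apply the retraction `r` and take the `κ`-coordinate
  have hrsb : appLE r (homOfLE hVW₂) sb = K.presheaf.map (homOfLE hVW₁).op (basisSection κ 0) := by
    have h1 : sb = σ.app Vb (K.presheaf.map (homOfLE hVW₁).op (basisSection κ 0)) := by
      change F.presheaf.map (homOfLE hVW₁).op (σ.app W₁ (basisSection κ 0)) = _
      rw [Scheme.Modules.Hom.app_map_apply]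
    rw [h1, ← appLE_over_map σ (homOfLE hVW₂), ← appLE_comp, hr, appLE_id]
  let rb : Fin 2 → Γ(Y, Vb) := fun j => coord κ (homOfLE hVW₁) (appLE r (homOfLE hVW₂) (bj j)) 0
  have hone : ∑ j, Ab j * rb j = 1 := by
    have h1 : coord κ (homOfLE hVW₁) (K.presheaf.map (homOfLE hVW₁).op (basisSection κ 0)) 0 = 1 := by
      rw [coord_map_basisSection]; simp
    rw [← hrsb, hexp, appLE_sum_right, coord_sum] at h1
    rw [← h1]
    refine Finset.sum_congr rfl fun j _ => ?_
    rw [appLE_smul_right, coord_smul]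
  -- (6) lift the coordinates and the unimodularity witnesses to `Γ(X₀, V)`
  choose A hA using fun j => exists_lift_section I e V (Ab j)
  choose rr hrr using fun j => exists_lift_section I e V (rb j)
  have hunit : (∑ j, rr j * A j) - 1 ∈ I.ideal V := by
    apply mem_ideal_of_app_eq_zero I e V
    simp only [map_sub, map_sum, map_mul, map_one, hA, hrr]
    rw [sub_eq_zero, ← hone]
    exact Finset.sum_congr rfl fun j _ => mul_comm _ _
  -- (7) assemble
  refine ⟨V, hzV', x, s, hgen, hs, eV, heV, A, rr, hunit, W₁, κ, hVW₁, ?_⟩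
  change sb = _
  rw [hexp]
  exact Finset.sum_congr rfl fun j _ => by rw [hA j]

end Summit.ResolutionOfSingularities.ResolutionOfSingularities.Cruxes.EquisingularLiftNat.Sections

end
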